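import Mathlib.Analysis.InnerProductSpace.Trace
import Mathlib.Analysis.Calculus.Deriv.Inv
import Literature.Geometry.Lorentzian.LeviCivitaProofs
import HarnessLib

/-!
# The curvature tensor of a metric on an open subset of a normed space, in coordinates;
# conformally flat metrics and the scalar curvature of `ψ⁴ δ` in dimension three

(trunk G08 = T-LORENTZ; namespace `Literature.Geometry.Lorentzian.OpensChart`; companion of
`ChartCalculus.lean`.)

`ChartCalculus.lean` computes the Levi-Civita connection `g.leviCivita` of a `C^n` metric `g` on
an open subset `U : Opens E` of a finite-dimensional real normed space on the *constant*
(coordinate) fields of the chart: `∇_{X₀} Y₀ = Γ_x(X₀, Y₀)` with the Christoffel map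
`OpensChart.christoffel g G x` of the components `G : E → (E →L E →L ℝ)` (O'Neill 1983, Ch. 3,
Prop. 3.13). This file continues the computation up to the curvature tensor
`g.leviCivita.curvature` (`Curvature.lean`, convention `R(X,Y)Z = ∇_X ∇_Y Z − ∇_Y ∇_X Z −
∇_{[X,Y]} Z`) and the scalar curvature `g.scalarCurvature` (`LeviCivita.lean`), and evaluates
everything for conformally flat metrics. Everything is proved; no named facts are introduced.

## Main results

General chart `U : Opens E` (section `General`):
* `mlieBracket_const_left/right` — brackets of a constant field with a represented field,
  `[X₀, W] = DŴ X₀`;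
* `koszulFunctional_const_mid`, `leviCivita_eq_of_repr`, `leviCivita_apply_of_repr` — **the
  Levi-Civita connection on an arbitrary differentiable field**: `∇_{X₀} W = DŴ(x) X₀ +
  Γ_x(X₀, Ŵ x)` (O'Neill 1983, Ch. 3, Prop. 3.13 (1)), by the Koszul formula and uniqueness;
* `curvatureAux_const` — **the coordinate formula for the curvature**:
  `R(X₀, Y₀)Z₀ = ∂_{X₀}Γ(Y₀, Z₀) + Γ(X₀, Γ(Y₀, Z₀)) − ∂_{Y₀}Γ(X₀, Z₀) − Γ(Y₀, Γ(X₀, Z₀))`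
  (O'Neill 1983, Ch. 3, Lemma 3.38), for Christoffel maps with a differentiable representative;
* `curvature_leviCivita_eq_curvatureAux_const` — the tensor `g.leviCivita.curvature x` *is*
  computed on the constant fields (`CovariantDerivative.curvature_apply_of_isLocallyContMDiff` of
  `CurvatureProofs.lean` with the regularity `isLocallyContMDiff_leviCivita_holds`).

Conformally flat metrics `G = φ δ` on an open subset of a finite-dimensional real inner product
space (section `Conformal`; `δ` is `innerSL ℝ` read as a bilinear map, hypothesis `hδ`):
* `fderiv_conformal_apply`, `koszulForm_conformal`, `christoffel_conformal` — **the Christoffel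
  symbols of `φ δ`**: `Γ(X, Y) = θ(X) Y + θ(Y) X − ⟪X, Y⟫ θ♯` with `θ = Dφ/(2φ)` (Besse 1987,
  Thm. 1.159, the Levi-Civita connection of `e^{2f} g`);
* `sharp_conformal_coord`, `scalarCurvature_conformal_eq_sum` — `gⁱʲ = φ⁻¹ δⁱʲ` and
  `S = φ⁻¹ ∑ᵢ ∑ₖ ⟪eₖ, R(eₖ, eᵢ) eᵢ⟫` in an orthonormal basis;
* `conformal_curvature_trace_identity` — the linear algebra of the double contraction in
  dimension `3`: `∑ᵢₖ ⟪eₖ, R(eₖ, eᵢ) eᵢ⟫ = −4 tr H − 2 |θ|²`;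
* `scalarCurvature_conformal_fourth_power` — **`S(ψ⁴ δ) = −8 ψ⁻⁵ Δψ` in dimension `3`**, the
  identity behind the Lichnerowicz equation of the conformal method (Bartnik–Isenberg 2004,
  §4.1, `R(φ⁴λ) = φ⁻⁵(R(λ)φ − 8Δ_λφ)` with `λ = δ`); consumed by
  `ModelDataProofs.lean` (the time-symmetric Schwarzschild data are scalar flat).

## Design

* As in `ChartCalculus.lean`, identities are stated at the model type `E`; representatives of
  fields (`Ŵ`), of the Christoffel maps (`Γc`), of `θ♯` (`t`) enter through pointwise hypotheses.
  Terms mixing `TangentSpace 𝓘(ℝ, E) x` and `E` are only ever bridged by `rw [hG x]` followed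
  by `change`/`exact` (they are definitionally, not reducibly, equal).
* The Euclidean metric is a variable `δ : E →L[ℝ] E →L[ℝ] ℝ` with `hδ : δ v w = ⟪v, w⟫`
  (instantiated by `innerSL ℝ`, whose own type is semilinear), so that `φ y • δ` lives in an
  honest normed space; `set_option maxSynthPendingDepth 3` is needed for instance search
  through this nested operator type (as in `Literature/Analysis/FluidPDE/NewtonKernel.lean`).
* Dimension `3` enters only through the final contraction, done by brute force on `Fin 3`
  (`conformal_curvature_trace_identity`, `ring`); the general-`n` statement
  `S = e^{−2f}(−2(n−1)Δf − (n−1)(n−2)|df|²)` is not needed downstream and not formalised.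

## References

* B. O'Neill, *Semi-Riemannian geometry with applications to relativity*, Academic Press 1983,
  Ch. 3: Thm. 3.11, Prop. 3.13, Lemma 3.35, Lemma 3.38, Def. 3.53 (key `ONeill1983`).
* A. Besse, *Einstein Manifolds*, Springer 1987, Thm. 1.159 (key `Besse1987`).
* R. Bartnik, J. Isenberg, *The constraint equations*, in: The Einstein equations and the
  large scale behavior of gravitational fields, Birkhäuser 2004, §4.1 (arXiv:gr-qc/0405092)
  (key `BartnikIsenberg2004`).
-/

noncomputable section

open Set Manifold TopologicalSpace Filter VectorField Bundle
open scoped ContDiff Topology Manifold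

namespace Literature.Geometry.Lorentzian

namespace OpensChart

section General

variable {E : Type*} [NormedAddCommGroup E] [NormedSpace ℝ E] {U : Opens E}

/-- The Lie bracket of a constant field `X₀` of the chart `U` with a field `W` represented by
`Ŵ : E → E`: `[X₀, W](x) = DŴ(x) X₀` (O'Neill 1983, Ch. 1, the bracket operation
`[V, W] = VW − WV`: in a chart `[V, W] = ∑ⱼ (V(Wʲ) − W(Vʲ)) ∂ⱼ`, and a constant field has
constant components). [folklore] -/
theorem mlieBracket_const_left (x : U) (X₀ : E) (W : Π y : U, TangentSpace 𝓘(ℝ, E) y)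
    (Ŵ : E → E) (hW : ∀ y : U, W y = Ŵ y) :
    mlieBracket 𝓘(ℝ, E) (fun _ : U ↦ (X₀ : E) : Π y : U, TangentSpace 𝓘(ℝ, E) y) W x =
      fderiv ℝ Ŵ x X₀ := by
  rw [mlieBracket_eq x _ _ (fun _ ↦ X₀) Ŵ (fun _ ↦ rfl) hW]
  simp only [lieBracket_eq, fderiv_fun_const, Pi.zero_apply, zero_apply, sub_zero]

/-- The Lie bracket of a field `W` represented by `Ŵ : E → E` with a constant field `Z₀` of the
chart `U`: `[W, Z₀](x) = −DŴ(x) Z₀` (O'Neill 1983, Ch. 1, the bracket operation in a chart).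
[folklore] -/
theorem mlieBracket_const_right (x : U) (W : Π y : U, TangentSpace 𝓘(ℝ, E) y) (Ŵ : E → E)
    (hW : ∀ y : U, W y = Ŵ y) (Z₀ : E) :
    mlieBracket 𝓘(ℝ, E) W (fun _ : U ↦ (Z₀ : E) : Π y : U, TangentSpace 𝓘(ℝ, E) y) x =
      -fderiv ℝ Ŵ x Z₀ := by
  rw [mlieBracket_eq x _ _ Ŵ (fun _ ↦ Z₀) hW (fun _ ↦ rfl)]
  simp only [lieBracket_eq, fderiv_fun_const, Pi.zero_apply, zero_apply, zero_sub]

variable [FiniteDimensional ℝ E] [CompleteSpace E] {n : ℕ∞ω} [Fact (1 ≤ n)]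
  {g : PseudoRiemannianMetric 𝓘(ℝ, E) n E (TangentSpace 𝓘(ℝ, E) : U → Type _)}
  {G : E → E →L[ℝ] E →L[ℝ] ℝ} (hG : ∀ y : U, g.val y = G y)
include hG

omit [FiniteDimensional ℝ E] [CompleteSpace E] [Fact (1 ≤ n)] in
/-- **The Koszul functional with a non-constant middle field.** For constant fields `X₀`, `Z₀`
of the chart and a field `W` with differentiable representative `Ŵ`,
`K(X₀, W, Z₀)(x) = K_G(X₀, Ŵ x, Z₀) + 2 G_x(DŴ(x) X₀, Z₀)`, where `K_G` is the Koszul form of the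
components (O'Neill 1983, Ch. 3, proof of Prop. 3.13 and Thm. 3.11 (D5)). [cite: ONeill1983, Ch. 3, Prop. 3.13] -/
theorem koszulFunctional_const_mid (x : U) (hGx : DifferentiableAt ℝ G x)
    {W : Π y : U, TangentSpace 𝓘(ℝ, E) y} {Ŵ : E → E} (hW : ∀ y : U, W y = Ŵ y)
    (hŴ : DifferentiableAt ℝ Ŵ x) (X₀ Z₀ : E) :
    g.koszulFunctional (fun _ : U ↦ (X₀ : E)) W (fun _ : U ↦ (Z₀ : E)) x =
      koszulForm G x (Ŵ x) X₀ Z₀ + 2 * G x (fderiv ℝ Ŵ x X₀) Z₀ := by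
  have hsym : ∀ v w : E, G x v w = G x w v := fun v w ↦ by
    have := g.symm x v w
    rw [hG] at this
    exact this
  have h1 : (fun y : U ↦ g.val y (W y) Z₀) = fun y : U ↦ G y (Ŵ y) Z₀ := by
    funext y; rw [hG, hW]; rfl
  have h2 : (fun y : U ↦ g.val y (Z₀ : TangentSpace 𝓘(ℝ, E) y) (X₀ : TangentSpace 𝓘(ℝ, E) y))
      = fun y : U ↦ G y Z₀ X₀ := by
    funext y; rw [hG]; rfl
  have h3 : (fun y : U ↦ g.val y (X₀ : TangentSpace 𝓘(ℝ, E) y) (W y)) =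
      fun y : U ↦ G y X₀ (Ŵ y) := by
    funext y; rw [hG, hW]; rfl
  have hd1 : DifferentiableAt ℝ (fun y ↦ G y (Ŵ y) Z₀) x :=
    (hGx.clm_apply hŴ).clm_apply (differentiableAt_const _)
  have hd3 : DifferentiableAt ℝ (fun y ↦ G y X₀ (Ŵ y)) x :=
    (hGx.clm_apply (differentiableAt_const _)).clm_apply hŴ
  have e1 : fderiv ℝ (fun y ↦ G y (Ŵ y) Z₀) x X₀ =
      fderiv ℝ G x X₀ (Ŵ x) Z₀ + G x (fderiv ℝ Ŵ x X₀) Z₀ := by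
    rw [fderiv_clm_apply (hGx.clm_apply hŴ) (differentiableAt_const Z₀),
      fderiv_clm_apply hGx hŴ, fderiv_fun_const]
    simp only [Pi.zero_apply, ContinuousLinearMap.comp_zero, zero_add,
      ContinuousLinearMap.flip_apply, add_apply, ContinuousLinearMap.coe_comp,
      Function.comp_apply]
    ring
  have e3 : fderiv ℝ (fun y ↦ G y X₀ (Ŵ y)) x Z₀ =
      fderiv ℝ G x Z₀ X₀ (Ŵ x) + G x X₀ (fderiv ℝ Ŵ x Z₀) := by
    rw [fderiv_clm_apply (hGx.clm_apply (differentiableAt_const X₀)) hŴ,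
      fderiv_clm_apply hGx (differentiableAt_const X₀), fderiv_fun_const]
    simp only [Pi.zero_apply, ContinuousLinearMap.comp_zero, zero_add,
      ContinuousLinearMap.flip_apply, add_apply, ContinuousLinearMap.coe_comp,
      Function.comp_apply]
    ring
  have b1 : g.val x (X₀ : TangentSpace 𝓘(ℝ, E) x)
      (mlieBracket 𝓘(ℝ, E) W (fun _ : U ↦ (Z₀ : E) : Π y : U, TangentSpace 𝓘(ℝ, E) y) x) =
      -(G x X₀ (fderiv ℝ Ŵ x Z₀)) := by
    rw [mlieBracket_const_right x W Ŵ hW Z₀, hG x]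
    exact (G x X₀).map_neg _
  have b2 : g.val x (Z₀ : TangentSpace 𝓘(ℝ, E) x)
      (mlieBracket 𝓘(ℝ, E) (fun _ : U ↦ (X₀ : E) : Π y : U, TangentSpace 𝓘(ℝ, E) y) W x) =
      G x (fderiv ℝ Ŵ x X₀) Z₀ := by
    rw [mlieBracket_const_left x X₀ W Ŵ hW, hG x]
    exact hsym _ _
  simp only [PseudoRiemannianMetric.koszulFunctional, mlieBracket_const, map_zero, add_zero,
    koszulForm_apply]
  rw [b1, b2, h1, h2, h3, mvfderiv_eq x _ (fun y ↦ G y (Ŵ y) Z₀) (fun _ ↦ rfl) hd1,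
    mvfderiv_eq x _ (fun y ↦ G y Z₀ X₀) (fun _ ↦ rfl) (differentiableAt_apply₂ G hGx _ _),
    mvfderiv_eq x _ (fun y ↦ G y X₀ (Ŵ y)) (fun _ ↦ rfl) hd3, e1, fderiv_apply₂ G hGx, e3,
    hW x]
  ring

omit [CompleteSpace E] [Fact (1 ≤ n)] in
/-- **The Levi-Civita connection of a chart on an arbitrary field.** For a metric on `U` with
components `G` differentiable at `x` and a field `W` with representative `Ŵ` differentiable at
`x`: `∇_{X₀} W (x) = DŴ(x) X₀ + Γ_x(X₀, Ŵ x)`, i.e. O'Neill 1983, Ch. 3, Prop. 3.13 (1):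
`D_V W = ∑ₖ (V(Wᵏ) + ∑ᵢⱼ Γᵏᵢⱼ Vⁱ Wʲ) ∂ₖ` (there derived from (D1)–(D5); here from the Koszul
formula, `koszulFunctional_const_mid`, and uniqueness, `leviCivita_eq_of_forall`).
[cite: ONeill1983, Ch. 3, Prop. 3.13] -/
theorem leviCivita_eq_of_repr [g.HasLeviCivita] (x : U) (hGx : DifferentiableAt ℝ G x)
    {W : Π y : U, TangentSpace 𝓘(ℝ, E) y} {Ŵ : E → E} (hW : ∀ y : U, W y = Ŵ y)
    (hŴ : DifferentiableAt ℝ Ŵ x) :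
    g.leviCivita W x = (fderiv ℝ Ŵ x : E →L[ℝ] E) + christoffel g G x (Ŵ x) := by
  refine g.leviCivita_eq_of_forall _ fun X₀ Z₀ ↦ ?_
  have hΓ : 2 * G x (christoffel g G x (Ŵ x) X₀) Z₀ = koszulForm G x (Ŵ x) X₀ Z₀ := by
    have := two_mul_val_christoffel (g := g) (G := G) x (Ŵ x) X₀ Z₀
    rw [hG x] at this
    exact this
  rw [extend_eq_const, extend_eq_const, koszulFunctional_const_mid hG x hGx hW hŴ X₀ Z₀, hG x]
  change 2 * G x (fderiv ℝ Ŵ x X₀ + christoffel g G x (Ŵ x) X₀) Z₀ =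
    koszulForm G x (Ŵ x) X₀ Z₀ + 2 * G x (fderiv ℝ Ŵ x X₀) Z₀
  rw [map_add, add_apply, ← hΓ]
  ring

omit [CompleteSpace E] [Fact (1 ≤ n)] in
/-- Pointwise form of `leviCivita_eq_of_repr`: `∇_{X₀} W (x) = DŴ(x) X₀ + Γ_x(X₀, Ŵ x)`
(O'Neill 1983, Ch. 3, Prop. 3.13 (1)). [cite: ONeill1983, Ch. 3, Prop. 3.13] -/
theorem leviCivita_apply_of_repr [g.HasLeviCivita] (x : U) (hGx : DifferentiableAt ℝ G x)
    {W : Π y : U, TangentSpace 𝓘(ℝ, E) y} {Ŵ : E → E} (hW : ∀ y : U, W y = Ŵ y)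
    (hŴ : DifferentiableAt ℝ Ŵ x) (X₀ : E) :
    g.leviCivita W x X₀ = fderiv ℝ Ŵ x X₀ + christoffel g G x (Ŵ x) X₀ := by
  rw [leviCivita_eq_of_repr hG x hGx hW hŴ]
  rfl

omit [CompleteSpace E] [Fact (1 ≤ n)] in
/-- **The curvature operation on the coordinate fields of a chart.** For a metric on `U` with
components `G` differentiable on `U`, Christoffel maps represented by `Γ̂` (`Γ_y(X₀, Y₀) =
Γ̂ y Y₀ X₀`) differentiable at `x` in `y` for the two pairs needed, and constant fields
`X₀, Y₀, Z₀`: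
`(∇_{X₀} ∇_{Y₀} Z₀ − ∇_{Y₀} ∇_{X₀} Z₀ − ∇_{[X₀, Y₀]} Z₀)(x)
  = ∂_{X₀}Γ̂(Y₀, Z₀) + Γ_x(X₀, Γ_x(Y₀, Z₀)) − ∂_{Y₀}Γ̂(X₀, Z₀) − Γ_x(Y₀, Γ_x(X₀, Z₀))`,
the classical coordinate formula for the components of `R` (O'Neill 1983, Ch. 3, Lemma 3.38,
p. 76: `Rⁱⱼₖₗ = ∂ₗΓⁱₖⱼ − ∂ₖΓⁱₗⱼ + ∑ₘ ΓⁱₗₘΓᵐₖⱼ − ∑ₘ ΓⁱₖₘΓᵐₗⱼ` in O'Neill's convention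
`R_{XY} = −R(X, Y)`, proved from `R_{∂ₖ∂ₗ}∂ⱼ = D_{∂ₗ}(D_{∂ₖ}∂ⱼ) − D_{∂ₖ}(D_{∂ₗ}∂ⱼ)` since the bracket of
coordinate fields vanishes). [cite: ONeill1983, Ch. 3, Lemma 3.38] -/
theorem curvatureAux_const [g.HasLeviCivita] (hGd : ∀ y : U, DifferentiableAt ℝ G y)
    {Γc : E → E → E → E} (hΓ : ∀ (y : U) (Y₀ X₀ : E), christoffel g G y Y₀ X₀ = Γc y Y₀ X₀)
    (x : U) (X₀ Y₀ Z₀ : E) (h₁ : DifferentiableAt ℝ (fun y ↦ Γc y Z₀ Y₀) x)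
    (h₂ : DifferentiableAt ℝ (fun y ↦ Γc y Z₀ X₀) x) :
    CovariantDerivative.curvatureAux g.leviCivita
        (fun _ : U ↦ (X₀ : E) : Π y : U, TangentSpace 𝓘(ℝ, E) y)
        (fun _ : U ↦ (Y₀ : E) : Π y : U, TangentSpace 𝓘(ℝ, E) y)
        (fun _ : U ↦ (Z₀ : E) : Π y : U, TangentSpace 𝓘(ℝ, E) y) x =
      fderiv ℝ (fun y ↦ Γc y Z₀ Y₀) x X₀ + Γc x (Γc x Z₀ Y₀) X₀
        - (fderiv ℝ (fun y ↦ Γc y Z₀ X₀) x Y₀ + Γc x (Γc x Z₀ X₀) Y₀) := by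
  have hin : ∀ V₀ : E,
      (fun y : U ↦ g.leviCivita (fun _ : U ↦ (Z₀ : E) : Π y : U, TangentSpace 𝓘(ℝ, E) y) y V₀) =
        fun y : U ↦ (Γc y Z₀ V₀ : E) := fun V₀ ↦
    funext fun y ↦ by rw [leviCivita_const_apply hG y (hGd y), hΓ]
  simp only [CovariantDerivative.curvatureAux, mlieBracket_const, map_zero, sub_zero]
  rw [hin Y₀, hin X₀,
    leviCivita_apply_of_repr hG x (hGd x) (W := fun y : U ↦ (Γc y Z₀ Y₀ : E)) (fun _ ↦ rfl) h₁,
    leviCivita_apply_of_repr hG x (hGd x) (W := fun y : U ↦ (Γc y Z₀ X₀ : E)) (fun _ ↦ rfl) h₂,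
    hΓ, hΓ]
  rfl

omit hG in
omit [Fact (1 ≤ n)] in
/-- **The curvature tensor of a chart metric is computed on constant fields**: for a `C^n`
metric on `U`, `n ≥ 2`, `R_x(X₀, Y₀) Z₀ = (∇_{X₀} ∇_{Y₀} Z₀ − ∇_{Y₀} ∇_{X₀} Z₀ − ∇_{[X₀,Y₀]} Z₀)(x)`
with `X₀, Y₀, Z₀` the constant fields of the chart (O'Neill 1983, Ch. 3, Lemma 3.35: `R` is a
tensor field and may be computed on any extensions; here `CovariantDerivative.curvature_apply_of_isLocallyContMDiff`
with the regularity `isLocallyContMDiff_leviCivita_holds` of the Levi-Civita connection).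
[cite: ONeill1983, Ch. 3, Lemma 3.35] -/
theorem curvature_leviCivita_eq_curvatureAux_const [Fact (1 ≤ n)] [g.HasLeviCivita]
    (hn : 2 ≤ n) (x : U) (X₀ Y₀ Z₀ : E) :
    g.leviCivita.curvature x X₀ Y₀ Z₀ =
      CovariantDerivative.curvatureAux g.leviCivita
        (fun _ : U ↦ (X₀ : E) : Π y : U, TangentSpace 𝓘(ℝ, E) y)
        (fun _ : U ↦ (Y₀ : E) : Π y : U, TangentSpace 𝓘(ℝ, E) y)
        (fun _ : U ↦ (Z₀ : E) : Π y : U, TangentSpace 𝓘(ℝ, E) y) x := by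
  have hreg : g.leviCivita.IsLocallyContMDiff 1 :=
    g.isLocallyContMDiff_leviCivita_holds 1 (by simpa [one_add_one_eq_two] using hn)
  have hc : ∀ V₀ : E, ContMDiffAt 𝓘(ℝ, E) (𝓘(ℝ, E).prod 𝓘(ℝ, E)) (minSmoothness ℝ 2)
      (fun y : U ↦ (TotalSpace.mk' E y (V₀ : TangentSpace 𝓘(ℝ, E) y) : TangentBundle 𝓘(ℝ, E) U))
      x := fun V₀ ↦
    (contMDiffAt_section_iff x (fun _ : U ↦ (V₀ : E))).2 contMDiffAt_const
  have hd : ∀ V₀ : E, MDifferentiableAt 𝓘(ℝ, E) (𝓘(ℝ, E).prod 𝓘(ℝ, E))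
      (fun y : U ↦ (TotalSpace.mk' E y (V₀ : TangentSpace 𝓘(ℝ, E) y) : TangentBundle 𝓘(ℝ, E) U))
      x := fun V₀ ↦
    mdifferentiableAt_const_section x V₀
  exact g.leviCivita.curvature_apply_of_isLocallyContMDiff hreg (hd X₀) (hd Y₀) (hc Z₀)

end General

/-! ## Conformally flat metrics `g = φ δ` on an open subset of an inner product space -/

section Conformal

open scoped RealInnerProductSpace

-- instance search through the nested operator type `E →L[ℝ] E →L[ℝ] ℝ` of the metric components
set_option maxSynthPendingDepth 3

variable {E : Type*} [NormedAddCommGroup E] [InnerProductSpace ℝ E] [FiniteDimensional ℝ E]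
  [CompleteSpace E] {U : Opens E} {n : ℕ∞ω} [Fact (1 ≤ n)]
  {g : PseudoRiemannianMetric 𝓘(ℝ, E) n E (TangentSpace 𝓘(ℝ, E) : U → Type _)}
  {G : E → E →L[ℝ] E →L[ℝ] ℝ} {φ : E → ℝ} {δ : E →L[ℝ] E →L[ℝ] ℝ}
  (hδ : ∀ v w : E, δ v w = ⟪v, w⟫) (hGφ : ∀ y : E, G y = φ y • δ)

/-! Throughout, `δ` is the Euclidean metric `innerSL ℝ` read as an honestly bilinear map
(hypothesis `hδ`; over `ℝ` the semilinear `innerSL` is bilinear, but its type is not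
syntactically `E →L[ℝ] E →L[ℝ] ℝ`), and `G = φ δ` are the components of the metric
(hypothesis `hGφ`). -/

include hGφ

omit [FiniteDimensional ℝ E] [CompleteSpace E] in
/-- The components `G = φ δ` are differentiable where `φ` is. [folklore] -/
theorem differentiableAt_conformal {x : E} (hφ : DifferentiableAt ℝ φ x) :
    DifferentiableAt ℝ G x := by
  have hGeq : G = fun y ↦ φ y • δ := funext hGφ
  rw [hGeq]
  exact hφ.smul_const δ

include hδ

omit [FiniteDimensional ℝ E] [CompleteSpace E] in
/-- The derivative of the components `G = φ δ` of a conformally flat metric: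
`DG(x)(v) = Dφ(x)(v) δ`, i.e. `∂ᵥ g_{ij} = (∂ᵥ φ) δ_{ij}`. Elementary calculus. [folklore] -/
theorem fderiv_conformal_apply {x : E} (hφ : DifferentiableAt ℝ φ x) (v Y Z : E) :
    fderiv ℝ G x v Y Z = fderiv ℝ φ x v * ⟪Y, Z⟫ := by
  have hGeq : G = fun y ↦ φ y • δ := funext hGφ
  have hd : HasFDerivAt (fun y ↦ φ y • δ) ((fderiv ℝ φ x).smulRight δ) x :=
    hφ.hasFDerivAt.smul_const δ
  rw [hGeq, hd.fderiv, ContinuousLinearMap.smulRight_apply, FunLike.coe_smul, Pi.smul_apply,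
    FunLike.coe_smul, Pi.smul_apply, hδ, smul_eq_mul]

omit [FiniteDimensional ℝ E] [CompleteSpace E] in
/-- **The Koszul form of a conformally flat metric** `g = φ δ`:
`K(X₀, Y₀, Z₀) = ∂_{X₀}φ ⟪Y₀, Z₀⟫ + ∂_{Y₀}φ ⟪Z₀, X₀⟫ − ∂_{Z₀}φ ⟪X₀, Y₀⟫` (O'Neill 1983, Ch. 3,
Prop. 3.13 with `g_{ij} = φ δ_{ij}`). [cite: ONeill1983, Ch. 3, Prop. 3.13] -/
theorem koszulForm_conformal {x : E} (hφ : DifferentiableAt ℝ φ x) (Y₀ X₀ Z₀ : E) :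
    koszulForm G x Y₀ X₀ Z₀ =
      fderiv ℝ φ x X₀ * ⟪Y₀, Z₀⟫ + fderiv ℝ φ x Y₀ * ⟪Z₀, X₀⟫ - fderiv ℝ φ x Z₀ * ⟪X₀, Y₀⟫ := by
  rw [koszulForm_apply, fderiv_conformal_apply hδ hGφ hφ, fderiv_conformal_apply hδ hGφ hφ,
    fderiv_conformal_apply hδ hGφ hφ]

variable (hG : ∀ y : U, g.val y = G y)
include hG

omit [CompleteSpace E] [Fact (1 ≤ n)] in
/-- **The Christoffel symbols of a conformally flat metric.** For `g = φ δ` on `U`, at a point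
`y` where `φ y ≠ 0` and `φ` is differentiable, with `θ_y = Dφ(y)/(2 φ(y))` (`= d log √φ`) and
`t_y = θ_y^♯` its Euclidean dual vector:
`Γ_y(X₀, Y₀) = θ_y(X₀) Y₀ + θ_y(Y₀) X₀ − ⟪X₀, Y₀⟫ t_y`, i.e.
`Γᵏᵢⱼ = δᵏⱼ ∂ᵢf + δᵏᵢ ∂ⱼf − δᵢⱼ ∂ᵏf` for `g = e^{2f} δ` (O'Neill 1983, Ch. 3, Prop. 3.13 (2)
evaluated for `g_{ij} = φ δ_{ij}`; Besse 1987, Thm. 1.159, the Levi-Civita connection of `e^{2f} g`).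
[cite: ONeill1983, Ch. 3, Prop. 3.13] -/
theorem christoffel_conformal {θ : E → E →L[ℝ] ℝ} {t : E → E}
    (ht : ∀ (y : E) (w : E), ⟪t y, w⟫ = θ y w) (y : U) (hφy : φ y ≠ 0)
    (hφd : DifferentiableAt ℝ φ y) (hθy : θ y = (2 * φ y)⁻¹ • fderiv ℝ φ y) (Y₀ X₀ : E) :
    christoffel g G y Y₀ X₀ = θ y X₀ • Y₀ + θ y Y₀ • X₀ - ⟪X₀, Y₀⟫ • t y := by
  rw [christoffel_apply]
  refine g.sharp_eq_of_forall y _ _ fun w ↦ ?_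
  rw [hG y, hGφ]
  change φ y * δ (θ y X₀ • Y₀ + θ y Y₀ • X₀ - ⟪X₀, Y₀⟫ • t y) w =
    2⁻¹ * koszulForm G y Y₀ X₀ w
  rw [hδ, koszulForm_conformal hδ hGφ hφd, inner_sub_left, inner_add_left, inner_smul_left,
    inner_smul_left, inner_smul_left, ht, hθy, real_inner_comm (show E from w) X₀]
  simp only [FunLike.coe_smul, Pi.smul_apply, smul_eq_mul, RCLike.conj_to_real]
  field_simp

omit [CompleteSpace E] [Fact (1 ≤ n)] in
/-- **Index raising for a conformally flat metric**: for `g = φ δ` and an orthonormal basis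
`(eⱼ)` of `(E, δ)`, `♯(eʲ) = φ⁻¹ eⱼ`, i.e. `gⁱʲ = φ⁻¹ δⁱʲ` (O'Neill 1983, Ch. 3, p. 60 and
Lemma 3.36). [cite: ONeill1983, Ch. 3, Prop. 3.10] -/
theorem sharp_conformal_coord {ι : Type*} [Fintype ι] (ob : OrthonormalBasis ι ℝ E) (x : U)
    (hφx : φ x ≠ 0) (j : ι) :
    ((g.sharp x).toLinearMap : Module.Dual ℝ E →ₗ[ℝ] E) (ob.toBasis.coord j) = (φ x)⁻¹ • ob j := by
  refine g.sharp_eq_of_forall x _ _ fun w ↦ ?_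
  rw [hG x, hGφ]
  change φ x * δ ((φ x)⁻¹ • ob j) w = ob.toBasis.coord j w
  rw [hδ, inner_smul_left, Module.Basis.coord_apply, ob.coe_toBasis_repr_apply,
    ob.repr_apply_apply, RCLike.conj_to_real, ← mul_assoc, mul_inv_cancel₀ hφx, one_mul]

omit [CompleteSpace E] [Fact (1 ≤ n)] in
/-- **The scalar curvature of a conformally flat metric as a double contraction.** For
`g = φ δ` on `U` (with its Levi-Civita connection) and an orthonormal basis `(eᵢ)` of `(E, δ)`:
`S(x) = φ(x)⁻¹ ∑ᵢ ∑ₖ ⟪eₖ, R_x(eₖ, eᵢ) eᵢ⟫` — the metric trace `gⁱʲ Ricᵢⱼ` with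
`gⁱʲ = φ⁻¹ δⁱʲ` (`sharp_conformal_coord`) of the Ricci tensor `Ric(Y, Z) = tr (v ↦ R(v, Y) Z)`
written in the basis `(eₖ)` (O'Neill 1983, Ch. 3, Def. 3.53 and Lemma 3.52).
[cite: ONeill1983, Ch. 3, Def. 3.53] -/
theorem scalarCurvature_conformal_eq_sum [g.HasLeviCivita] {ι : Type*} [Fintype ι]
    [DecidableEq ι] (ob : OrthonormalBasis ι ℝ E) (x : U) (hφx : φ x ≠ 0) :
    g.scalarCurvature x =
      (φ x)⁻¹ * ∑ i, ∑ k, ⟪ob k, (g.leviCivita.curvature x (ob k) (ob i) (ob i) : E)⟫ := by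
  have h1 : g.scalarCurvature x = ∑ i, ∑ j,
      ob.toBasis.coord i (((g.sharp x).toLinearMap : Module.Dual ℝ E →ₗ[ℝ] E)
        (ob.toBasis.coord j)) * g.ricci x (ob i) (ob j) :=
    trace_comp_bilinForm_eq_sum ob.toBasis _ _
  have h2 : ∀ Y Z : E, g.ricci x Y Z =
      ∑ k, ⟪ob k, (g.leviCivita.curvature x (ob k) Y Z : E)⟫ := fun Y Z ↦
    LinearMap.trace_eq_sum_inner (show E →ₗ[ℝ] E from g.leviCivita.ricciAux x Y Z) ob
  have h3 : ∀ i j, ob.toBasis.coord i (((g.sharp x).toLinearMap : Module.Dual ℝ E →ₗ[ℝ] E)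
      (ob.toBasis.coord j)) = if i = j then (φ x)⁻¹ else 0 := fun i j ↦ by
    rw [sharp_conformal_coord hδ hGφ hG ob x hφx j, map_smul, Module.Basis.coord_apply,
      ob.coe_toBasis_repr_apply, ob.repr_apply_apply, ob.inner_eq_ite, smul_eq_mul, mul_ite,
      mul_one, mul_zero]
  rw [h1]
  simp_rw [h3, ite_mul, zero_mul, Finset.sum_ite_eq, Finset.mem_univ, if_true, h2,
    Finset.mul_sum]

omit hG hGφ hδ in
omit [FiniteDimensional ℝ E] [CompleteSpace E] [Fact (1 ≤ n)] in
/-- The derivative of the conformal Christoffel map `y ↦ Γ_y(Y, Z) = θ_y(Y) Z + θ_y(Z) Y −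
⟪Y, Z⟫ t_y` in the base point: `∂ᵥ Γ(Y, Z) = (∂ᵥθ)(Y) Z + (∂ᵥθ)(Z) Y − ⟪Y, Z⟫ ∂ᵥ t`.
Elementary calculus. [folklore] -/
theorem hasFDerivAt_christoffel_conformal {θ : E → E →L[ℝ] ℝ} {t : E → E} {x : E}
    {θ' : E →L[ℝ] E →L[ℝ] ℝ} {t' : E →L[ℝ] E} (hθ : HasFDerivAt θ θ' x)
    (ht : HasFDerivAt t t' x) (Z Y : E) :
    HasFDerivAt (fun y ↦ θ y Y • Z + θ y Z • Y - ⟪Y, Z⟫ • t y)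
      ((θ'.flip Y).smulRight Z + (θ'.flip Z).smulRight Y - ⟪Y, Z⟫ • t') x := by
  have h1 : HasFDerivAt (fun y ↦ θ y Y) (θ'.flip Y) x := by
    have := hθ.clm_apply (hasFDerivAt_const Y x)
    simpa using this
  have h2 : HasFDerivAt (fun y ↦ θ y Z) (θ'.flip Z) x := by
    have := hθ.clm_apply (hasFDerivAt_const Z x)
    simpa using this
  exact ((h1.smul_const Z).add (h2.smul_const Y)).sub (ht.const_smul ⟪Y, Z⟫)

omit hG hGφ hδ in
omit [FiniteDimensional ℝ E] [CompleteSpace E] [Fact (1 ≤ n)] in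
/-- **The trace identity behind `R(e^{2f} δ) = −e^{−2f}(4 Δf + 2 |df|²)` in dimension `3`.**
Pure linear algebra: for an orthonormal basis `e₀, e₁, e₂`, a covector `θ₀` with dual vector
`t₀ = ∑ θ₀(eₗ) eₗ`, and coefficients `H(v, w)` (the derivative of `θ` along `v`, applied to
`w`) with `h(v) = ∑ H(v, eₗ) eₗ`, the double contraction `∑ᵢₖ ⟪eₖ, R(eₖ, eᵢ) eᵢ⟫` of the
coordinate curvature expression `R(X, Y)Z = ∂_XΓ(Y,Z) + Γ(X, Γ(Y,Z)) − ∂_YΓ(X,Z) − Γ(Y, Γ(X,Z))`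
built from `Γ(Y, Z) = θ₀(Y) Z + θ₀(Z) Y − ⟪Y, Z⟫ t₀` equals `−4 ∑ᵢ H(eᵢ, eᵢ) − 2 ∑ᵢ θ₀(eᵢ)²`
(Besse 1987, Thm. 1.159, the Ricci and scalar curvature of `e^{2f} g`; here `n = 3`, `g = δ`).
[cite: Besse1987, Thm. 1.159] -/
theorem conformal_curvature_trace_identity (ob : OrthonormalBasis (Fin 3) ℝ E)
    (θ₀ : E →L[ℝ] ℝ) (H : E → E → ℝ) {t₀ : E} (ht₀ : t₀ = ∑ l, θ₀ (ob l) • ob l) {h : E → E}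
    (hh : ∀ v, h v = ∑ l, H v (ob l) • ob l) {Γ₀ : E → E → E}
    (hΓ₀ : ∀ Z Y, Γ₀ Z Y = θ₀ Y • Z + θ₀ Z • Y - ⟪Y, Z⟫ • t₀) {DΓ : E → E → E → E}
    (hDΓ : ∀ v Z Y, DΓ v Z Y = H v Y • Z + H v Z • Y - ⟪Y, Z⟫ • h v) :
    ∑ i, ∑ k, ⟪ob k, DΓ (ob k) (ob i) (ob i) + Γ₀ (Γ₀ (ob i) (ob i)) (ob k)
        - (DΓ (ob i) (ob i) (ob k) + Γ₀ (Γ₀ (ob i) (ob k)) (ob i))⟫ =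
      -4 * ∑ i, H (ob i) (ob i) - 2 * ∑ i, θ₀ (ob i) ^ 2 := by
  have h00 := ob.inner_eq_one 0
  have h11 := ob.inner_eq_one 1
  have h22 := ob.inner_eq_one 2
  have h01 : ⟪ob 0, ob 1⟫ = 0 := ob.inner_eq_zero (by decide)
  have h02 : ⟪ob 0, ob 2⟫ = 0 := ob.inner_eq_zero (by decide)
  have h12 : ⟪ob 1, ob 2⟫ = 0 := ob.inner_eq_zero (by decide)
  have h10 : ⟪ob 1, ob 0⟫ = 0 := ob.inner_eq_zero (by decide)
  have h20 : ⟪ob 2, ob 0⟫ = 0 := ob.inner_eq_zero (by decide)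
  have h21 : ⟪ob 2, ob 1⟫ = 0 := ob.inner_eq_zero (by decide)
  simp only [hDΓ, hΓ₀, hh, ht₀, Fin.sum_univ_three, inner_add_right, inner_sub_right,
    inner_smul_right, map_add, map_sub, map_smul, smul_eq_mul, h00, h11, h22, h01, h02, h12,
    h10, h20, h21]
  ring

omit hGφ in
/-- **The scalar curvature of `g = ψ⁴ δ` in dimension three: `S = −8 ψ⁻⁵ Δψ`.** For a metric
on `U ⊆ E`, `dim E = 3`, with components `ψ⁴ δ`, where `ψ` is differentiable and non-vanishing
on `U` and its differential `Dψ` has derivative `F'` at `x` (so that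
`Δψ(x) = ∑ᵢ F'(eᵢ, eᵢ)` in any orthonormal basis `(eᵢ)`), the scalar curvature at `x` is
`−8 ψ(x)⁻⁵ ∑ᵢ F'(eᵢ, eᵢ)`. This is the identity behind the Lichnerowicz equation of the
conformal method (Bartnik–Isenberg 2004, §4.1: for `γ = φ⁴ λ`, `R(γ) = φ⁻⁵ (R(λ) φ − 8 Δ_λ φ)`,
here with `λ = δ` flat; Besse 1987, Thm. 1.159, the scalar curvature of `e^{2f} g`, with `n = 3`,
`e^{2f} = ψ⁴`). Proof: the
trace formula `scalarCurvature_conformal_eq_sum`, the coordinate expression of the curvature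
(`curvature_leviCivita_eq_curvatureAux_const`, `curvatureAux_const`) with the conformal
Christoffel symbols (`christoffel_conformal`, `θ = 2 Dψ/ψ`), and the trace identity
`conformal_curvature_trace_identity`. [cite: BartnikIsenberg2004, §4.1 (Lichnerowicz equation)] -/
theorem scalarCurvature_conformal_fourth_power [g.HasLeviCivita] (hn : 2 ≤ n) {ψ : E → ℝ}
    (hGψ : ∀ y : E, G y = ψ y ^ 4 • δ) (ob : OrthonormalBasis (Fin 3) ℝ E) (x : U)
    (hψU : ∀ y : U, ψ y ≠ 0) (hψd : ∀ y : U, DifferentiableAt ℝ ψ y)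
    {F' : E →L[ℝ] E →L[ℝ] ℝ} (hF' : HasFDerivAt (fderiv ℝ ψ) F' x) :
    g.scalarCurvature x = -8 * (ψ x ^ 5)⁻¹ * ∑ i, F' (ob i) (ob i) := by
  have hGφ : ∀ y : E, G y = (fun z ↦ ψ z ^ 4) y • δ := hGψ
  -- the logarithmic differential `θ = 2 Dψ / ψ = D(ψ⁴) / (2 ψ⁴)` and its dual vector field `t`
  set θ : E → E →L[ℝ] ℝ := fun y ↦ (2 * (ψ y)⁻¹) • fderiv ℝ ψ y with hθdef
  set t : E → E := fun y ↦ ∑ l, θ y (ob l) • ob l with htdef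
  have ht : ∀ y w : E, ⟪t y, w⟫ = θ y w := fun y w ↦ by
    rw [htdef, sum_inner]
    simp_rw [real_inner_smul_left]
    calc ∑ l, θ y (ob l) * ⟪ob l, w⟫ = θ y (∑ l, ⟪ob l, w⟫ • ob l) := by
          rw [map_sum]
          exact Finset.sum_congr rfl fun l _ ↦ by rw [map_smul, smul_eq_mul, mul_comm]
      _ = θ y w := by rw [ob.sum_repr' w]
  have hφU : ∀ y : U, ψ y ^ 4 ≠ 0 := fun y ↦ pow_ne_zero 4 (hψU y)
  have hφd : ∀ y : U, DifferentiableAt ℝ (fun z ↦ ψ z ^ 4) y := fun y ↦ (hψd y).pow 4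
  have hθφ : ∀ y : U, θ y = (2 * ψ y ^ 4)⁻¹ • fderiv ℝ (fun z ↦ ψ z ^ 4) y := fun y ↦ by
    have hsc : (2 * (ψ y)⁻¹ : ℝ) = (2 * ψ y ^ 4)⁻¹ * ((4 : ℕ) • ψ y ^ (4 - 1)) := by
      rw [nsmul_eq_mul]
      field_simp [hψU y]
      norm_num
    rw [((hψd y).hasFDerivAt.pow 4).fderiv, smul_smul, ← hsc, hθdef]
  have hGd : ∀ y : U, DifferentiableAt ℝ G y := fun y ↦ differentiableAt_conformal hGφ (hφd y)
  have hΓ : ∀ (y : U) (Y₀ X₀ : E),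
      christoffel g G y Y₀ X₀ = θ y X₀ • Y₀ + θ y Y₀ • X₀ - ⟪X₀, Y₀⟫ • t y := fun y Y₀ X₀ ↦
    christoffel_conformal hδ hGφ hG ht y (hφU y) (hφd y) (hθφ y) Y₀ X₀
  -- derivatives at `x`
  have hψx : HasFDerivAt ψ (fderiv ℝ ψ x) x := (hψd x).hasFDerivAt
  have hinv : HasFDerivAt (fun y ↦ (ψ y)⁻¹) ((-(ψ x ^ 2)⁻¹) • fderiv ℝ ψ x) x :=
    (hasDerivAt_inv (hψU x)).comp_hasFDerivAt (x : E) hψx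
  have hc : HasFDerivAt (fun y ↦ 2 * (ψ y)⁻¹) ((2 : ℝ) • ((-(ψ x ^ 2)⁻¹) • fderiv ℝ ψ x)) x :=
    hinv.const_mul 2
  set θ' : E →L[ℝ] E →L[ℝ] ℝ :=
    (2 * (ψ x)⁻¹) • F' + ((2 : ℝ) • ((-(ψ x ^ 2)⁻¹) • fderiv ℝ ψ x)).smulRight (fderiv ℝ ψ x)
    with hθ'def
  have hθ' : HasFDerivAt θ θ' x := by
    rw [hθdef]
    exact hc.smul hF'
  have hθl : ∀ w : E, HasFDerivAt (fun y ↦ θ y w) (θ'.flip w) x := fun w ↦ by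
    have := hθ'.clm_apply (hasFDerivAt_const w (x : E))
    simpa using this
  set t' : E →L[ℝ] E := ∑ l, (θ'.flip (ob l)).smulRight (ob l) with ht'def
  have ht' : HasFDerivAt t t' x := by
    rw [htdef]
    exact HasFDerivAt.fun_sum fun l _ ↦ (hθl (ob l)).smul_const (ob l)
  have ht'v : ∀ v : E, t' v = ∑ l, θ' v (ob l) • ob l := fun v ↦ by
    rw [ht'def]
    simp only [FunLike.coe_sum, Finset.sum_apply, ContinuousLinearMap.smulRight_apply,
      ContinuousLinearMap.flip_apply]
  -- the curvature tensor on the orthonormal frame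
  set Γ₀ : E → E → E := fun Z Y ↦ θ x Y • Z + θ x Z • Y - ⟪Y, Z⟫ • t x with hΓ₀def
  set DΓ : E → E → E → E := fun v Z Y ↦ θ' v Y • Z + θ' v Z • Y - ⟪Y, Z⟫ • t' v with hDΓdef
  have hcurv : ∀ X₀ Y₀ Z₀ : E, (g.leviCivita.curvature x X₀ Y₀ Z₀ : E) =
      DΓ X₀ Z₀ Y₀ + Γ₀ (Γ₀ Z₀ Y₀) X₀ - (DΓ Y₀ Z₀ X₀ + Γ₀ (Γ₀ Z₀ X₀) Y₀) := by
    intro X₀ Y₀ Z₀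
    rw [curvature_leviCivita_eq_curvatureAux_const hn x X₀ Y₀ Z₀,
      curvatureAux_const hG hGd (Γc := fun y Z Y ↦ θ y Y • Z + θ y Z • Y - ⟪Y, Z⟫ • t y) hΓ x
        X₀ Y₀ Z₀ (hasFDerivAt_christoffel_conformal hθ' ht' Z₀ Y₀).differentiableAt
        (hasFDerivAt_christoffel_conformal hθ' ht' Z₀ X₀).differentiableAt,
      (hasFDerivAt_christoffel_conformal hθ' ht' Z₀ Y₀).fderiv,
      (hasFDerivAt_christoffel_conformal hθ' ht' Z₀ X₀).fderiv]
    simp only [hDΓdef, hΓ₀def, add_apply, sub_apply, ContinuousLinearMap.smulRight_apply,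
      ContinuousLinearMap.flip_apply, FunLike.coe_smul, Pi.smul_apply]
  rw [scalarCurvature_conformal_eq_sum hδ hGφ hG ob x (hφU x)]
  simp_rw [hcurv]
  rw [conformal_curvature_trace_identity ob (θ x) (fun v w ↦ θ' v w) (t₀ := t x)
    (by rw [htdef]) (h := fun v ↦ t' v) ht'v (Γ₀ := Γ₀) (fun Z Y ↦ by rw [hΓ₀def])
    (DΓ := DΓ) (fun v Z Y ↦ by rw [hDΓdef])]
  -- the final algebra: `θ'(v, v) = 2 F'(v,v)/ψ − 2 Dψ(v)²/ψ²`, `θ(v) = 2 Dψ(v)/ψ`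
  simp only [hθ'def, hθdef, add_apply, ContinuousLinearMap.smulRight_apply, FunLike.coe_smul,
    Pi.smul_apply, smul_eq_mul, Fin.sum_univ_three]
  field_simp [hψU x]
  ring

end Conformal

end OpensChart

end Literature.Geometry.Lorentzian

end
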